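import Literature.NumberTheory.EllipticCurves.ZpExtensionIdelicCharacterRankProofs
import Literature.NumberTheory.EllipticCurves.ZpExtensionLocalUnitsProofs
import Literature.NumberTheory.EllipticCurves.AnticyclotomicPrimeDecomposition
import Literature.NumberTheory.GaloisRepresentations.GlobalArtinMapBlockNormProofs
import Literature.NumberTheory.Automorphic.GaloisActionPlaces
import Literature.NumberTheory.NumberFields.PadicLocalDegreesTower
import HarnessLib

/-!
# Brink 2007, Theorem 2: a prime `v ∤ p` over a rational prime split in an imaginary quadratic field
# is finitely decomposed in the anticyclotomic `ℤ_p`-extension — discharge of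
# `ZpExtension.decomp_not_le_kerSubgroup_of_isAnticyclotomic` (proofs only)

Topic `NumberTheory/EllipticCurves` (Iwasawa theory of `ℤ_p`-extensions); namespace
`Literature.NumberTheory.EllipticCurves.ZpExtension`.  THEOREMS ONLY (no definition, no named fact, no
instance; D-0026; net named-fact debt −1).  Third of three files (after
`ZpExtensionIdelicCharacterProofs.lean`, `ZpExtensionIdelicCharacterRankProofs.lean`).

## The print

D. Brink, *Prime decomposition in the anti-cyclotomic extension*, Math. Comp. 76 (2007) [Brink2007],
Thm. 2 (pp. 2134–2135), last assertion: "Assume that `𝔭` is different from `l` and splits in `K`.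
… `𝔭` only splits in a finite number of steps of `K^anti`"; Cor. 1 (p. 2136): "No rational prime `p`
splits completely in `K^anti`."  The tree's transcription (`AnticyclotomicPrimeDecomposition.lean`):
for `p` odd, `K` imaginary quadratic, `κ` anticyclotomic (`IsAnticyclotomic`: every `ρ ∈ Γ_ℚ ∖ Γ_K`
inverts `Gal(K_∞/K) ≃ ℤ_p`; Brink §II Prop. 1) and a finite place `v ∤ p` of degree one
(`e(v|ℚ) = f(v|ℚ) = 1`), the decomposition group `D_v ≤ Γ_K` (`GreenbergSelmer.decomp v`) is NOT
contained in `ker κ = Gal(K̄/K_∞)`.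

## The proof given here

Brink's proof computes the decomposition inside the ring class fields of `l`-power conductor
(Thm. 2: `K^anti ⊆ ⋃ₙ K[lⁿ]`).  The tree has no ring class field tower but it has PROVED global class
field theory (`…/NumberFields/IdelicArtinMap`: `[·, K] : 𝕀_K ↠ Γ_K^ab`, `[Kˣ, K] = 1`, Frobenius,
local–global compatibility `ArtinLocalGlobal`, transport `absGaloisConjAb_ideleArtinMap`) and the
structure of the local units above `p` (`PRamified.exists_openSubgroup_localUnits_equiv_holds`:
`U_p ⊇ W ≅ ℤ_p^{[K:ℚ]}` open of finite index, Lang Ch. 5 §5).  We run the idelic version of the same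
computation (Lang, *Cyclotomic Fields I–II*, Ch. 5 §5: `Gal(M/K) ∼ U_p/Ē ∼ ℤ_p²`; Brink §II
Prop. 1: `K^cycl` and `K^anti` are the `+`/`−` eigen-lines):

1. `Λ = κ^ab ∘ [·, K] : 𝕀_K → ℤ_p` (FILE 1).  If `D_v ≤ ker κ` then `Λ(⟨K_vˣ⟩) = 1` (local–global
   compatibility).  With `v^h = (π)` (finiteness of the class group) the product formula for the
   principal idele `π` over `{w ∣ p} ∪ {v}` gives `Λ(P) = 1`, `P = ∏_{w ∣ p} ⟨π⟩_w`.
2. Let `c = ḡ` be the non-trivial automorphism of `K` (`g ∈ Γ_ℚ ∖ Γ_K`) and `k = c(π)/π`; then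
   `∏_{w ∣ p} ⟨k⟩_w = (c • P) P⁻¹`, and by transport (Neukirch IV (5.8)) `Λ(c • P) = Λ(P)⁻¹` (`κ`
   anticyclotomic) while `Λ'(c • P) = Λ'(P)` for the `ℤ_p`-extension `κ'` of `K` coming from `ℚ`
   (FILE 2 §2).  Hence BOTH `Λ` and `Λ'` kill `Q = ∏_{w ∣ p} ⟨k⟩_w`, an element of `U_p` (`k` is a
   unit above `p`).
3. `Λ|_{U_p}` and `Λ'|_{U_p}` are `ℤ_p`-independent (FILE 2 §3: a combination killing `U_p` is the
   idelic character of `κ^a κ'^b`, which would then be trivial — FILE 1 §3 — and `a κ + b κ' = 0`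
   with its `c`-conjugate `-a κ + b κ' = 0` forces `a = b = 0`).  Two independent additive (hence
   `ℤ_p`-linear) forms on `W ≅ ℤ_p²` have common zero `0` only, so `k^{[U_p : W]} = 1` in `U_p`
   (rank-two lemma, FILE 2 §1), i.e. `k^m = 1` in `K`.
4. But `|k|_v = exp h ≠ 1`: `v ≠ c v` for a place of degree one in a quadratic field
   (`∑ e f = 2`), and `(π) = v^h`.  Contradiction.

The hypothesis `p ≠ 2` of the fact is not used (nor is any hypothesis on the splitting of `p` in
`K`); of `IsImaginaryQuadratic K` both `[K : ℚ] = 2` and total complexity (`[K_∞ˣ, K] = 1`) are used.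
Stated for `K : Type`, the universe of the tree's idelic class field theory and of every consumer
(`X11b.r1LocalKernelOrderAt_of_anticyclotomicDecomposition`, `ControlFacts` of the K1 door).

## References

* D. Brink, *Prime decomposition in the anti-cyclotomic extension*, Math. Comp. 76 (2007),
  2127–2138: Thm. 2 (pp. 2134–2135), Cor. 1 (p. 2136), §II Prop. 1 (p. 2130). [Brink2007]
* S. Lang, *Cyclotomic Fields I and II*, GTM 121 (1990), Ch. 5 §5, Thm. 5.1–5.2. [Lang1990]
* J. Neukirch, *Algebraic Number Theory* (1999), Ch. I §3 (3.3), §6 (6.3); Ch. IV §5 (5.8); Ch. VI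
  §5 (5.6); Ch. VII §6 (6.13). [NeukirchANT1999]
* J. Tate, *Global class field theory*, Ch. VII of Cassels–Fröhlich (1967), §1.1, §4.2, Thm. 11.5.
  [CasselsFrohlichANT1967]
* L. C. Washington, *Introduction to Cyclotomic Fields* (1997), §13.1–13.2. [Washington1997]

## Tree search

`lean search 'decomp_not_le_kerSubgroup_of_isAnticyclotomic_holds'`: no prior discharge (the
companion `…_above_of_isAnticyclotomic_holds`, Brink Cor. 1 at `p`, is
`AnticyclotomicPrimeDecompositionAboveProofs.lean`); the private quadratic-field helpers of
`AnticyclotomicLocalNormResidueSymbolProofs.lean` (`smul_ne_self_of_degree_one`, valuations of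
`c(π)/π`) are re-proved here privately.
-/

noncomputable section

open Field NumberField IsDedekindDomain
open scoped Pointwise

namespace Literature.NumberTheory.EllipticCurves.ZpExtension

open Literature.NumberTheory.GaloisRepresentations Literature.NumberTheory.NumberFields
open Literature.NumberTheory.Automorphic Literature.NumberTheory.EllipticCurves.PRamified

/-! ### §1. Quadratic fields: the non-trivial automorphism moves a place of degree one -/

section Quadratic

variable {K : Type} [Field K] [NumberField K]

/-- `#Gal(K/ℚ) = 2` for a quadratic field. [folklore] -/
private theorem card_algEquiv (hK2 : Module.finrank ℚ K = 2) : Fintype.card (K ≃ₐ[ℚ] K) = 2 := by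
  haveI : Algebra.IsQuadraticExtension ℚ K := ⟨hK2⟩
  rw [← Nat.card_eq_fintype_card, IsGalois.card_aut_eq_finrank, hK2]

/-- Every automorphism of a quadratic field is `1` or the non-trivial one `c`. [folklore] -/
private theorem eq_one_or_eq (hK2 : Module.finrank ℚ K = 2) {c : K ≃ₐ[ℚ] K} (hc : c ≠ 1)
    (σ : K ≃ₐ[ℚ] K) : σ = 1 ∨ σ = c := by
  classical
  by_contra h
  rw [not_or] at h
  have hlt : 2 < Fintype.card (K ≃ₐ[ℚ] K) := by
    rw [← Finset.card_univ]
    exact Finset.two_lt_card_iff.mpr ⟨1, c, σ, Finset.mem_univ _, Finset.mem_univ _,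
      Finset.mem_univ _, hc.symm, fun h1 => h.1 h1.symm, fun h2 => h.2 h2.symm⟩
  rw [card_algEquiv hK2] at hlt
  exact lt_irrefl _ hlt

/-- **A place of degree one in a quadratic field is moved by the non-trivial automorphism**:
`∑_{u ∣ ℓ} e_u f_u = 2` with `e_v f_v = 1` leaves a second place above `ℓ`, which is `c v` by
transitivity of `Gal(K/ℚ)` on the places above `ℓ`. [folklore] -/
private theorem smul_ne_self_of_degree_one (hK2 : Module.finrank ℚ K = 2) {c : K ≃ₐ[ℚ] K}
    (hc : c ≠ 1) {v : HeightOneSpectrum (𝓞 K)}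
    (he : v.asIdeal.ramificationIdx (𝓞 ℚ) = 1) (hf : v.asIdeal.inertiaDeg (𝓞 ℚ) = 1) :
    c • v ≠ v := by
  classical
  haveI : Algebra.IsQuadraticExtension ℚ K := ⟨hK2⟩
  intro hcv
  set P : Ideal (𝓞 ℚ) := (v.under (𝓞 ℚ)).asIdeal with hP
  haveI hPmax : P.IsMaximal := (v.under (𝓞 ℚ)).isMaximal
  have hall : ∀ 𝔓 : P.primesOver (𝓞 K), (𝔓 : Ideal (𝓞 K)) = v.asIdeal := by
    intro 𝔓
    have h𝔓ne : (𝔓 : Ideal (𝓞 K)) ≠ ⊥ := by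
      haveI : (𝔓 : Ideal (𝓞 K)).IsPrime := 𝔓.2.1
      haveI : (𝔓 : Ideal (𝓞 K)).LiesOver P := 𝔓.2.2
      exact Ideal.ne_bot_of_liesOver_of_ne_bot (Ring.ne_bot_of_isMaximal_of_not_isField hPmax
        (RingOfIntegers.not_isField ℚ)) (𝔓 : Ideal (𝓞 K))
    set u : HeightOneSpectrum (𝓞 K) := ⟨𝔓, 𝔓.2.1, h𝔓ne⟩ with hu
    have huv : u.under (𝓞 ℚ) = v.under (𝓞 ℚ) := by
      apply HeightOneSpectrum.ext
      rw [HeightOneSpectrum.under_asIdeal, HeightOneSpectrum.under_asIdeal]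
      exact 𝔓.2.2.over.symm
    obtain ⟨σ, hσ⟩ := HeightOneSpectrum.exists_algEquiv_smul_eq (F := ℚ) huv.symm
    rcases eq_one_or_eq hK2 hc σ with rfl | rfl
    · rw [one_smul] at hσ; exact congrArg HeightOneSpectrum.asIdeal hσ.symm
    · rw [hcv] at hσ; exact congrArg HeightOneSpectrum.asIdeal hσ.symm
  have hsum := sum_ramificationIdx_mul_inertiaDeg_eq_finrank_of_isMaximal ℚ K P
  rw [Algebra.IsQuadraticExtension.finrank_eq_two] at hsum
  have hv : v.asIdeal ∈ P.primesOver (𝓞 K) :=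
    ⟨v.isPrime, ⟨(HeightOneSpectrum.under_asIdeal (𝓞 ℚ) v).symm⟩⟩
  haveI : Subsingleton (P.primesOver (𝓞 K)) := ⟨fun a b => Subtype.ext ((hall a).trans (hall b).symm)⟩
  letI : Unique (P.primesOver (𝓞 K)) := uniqueOfSubsingleton ⟨v.asIdeal, hv⟩
  rw [Fintype.sum_unique] at hsum
  change v.asIdeal.ramificationIdx (𝓞 ℚ) * v.asIdeal.inertiaDeg (𝓞 ℚ) = 2 at hsum
  rw [he, hf] at hsum
  exact absurd hsum (by norm_num)

/-- `|c(π)/π|_u = 1` at every place `u ∉ {v, c v}`, when `v^h = (π)`. [folklore] -/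
private theorem valuation_div_eq_one (c : K ≃ₐ[ℚ] K) {v u : HeightOneSpectrum (𝓞 K)} (huv : u ≠ v)
    (hucv : u ≠ c • v) {h : ℕ} {π : 𝓞 K} (hπ : v.asIdeal ^ h = Ideal.span {π}) :
    u.valuation K (c (π : K) / (π : K)) = 1 := by
  have h1 : u.valuation K (π : K) = 1 := valuation_eq_one_of_pow_asIdeal_eq_span hπ huv
  have h2 : u.valuation K (c (π : K)) = 1 := by
    have hu : c • (c⁻¹ • u) = u := smul_inv_smul c u
    have h3 := HeightOneSpectrum.valuation_algEquiv_smul (F := ℚ) c (c⁻¹ • u) (π : K)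
    rw [hu] at h3
    rw [h3]
    exact valuation_eq_one_of_pow_asIdeal_eq_span hπ (fun h' => hucv (by rw [← h', smul_inv_smul]))
  rw [map_div₀, h1, h2, div_one]

/-- `|c(π)/π|_v = exp h` at `v`, when `v^h = (π)`, `π ≠ 0` and `c v ≠ v`. [folklore] -/
private theorem valuation_div_eq_exp (c : K ≃ₐ[ℚ] K) {v : HeightOneSpectrum (𝓞 K)} (hcv : c • v ≠ v)
    {h : ℕ} {π : 𝓞 K} (hπ0 : π ≠ 0) (hπ : v.asIdeal ^ h = Ideal.span {π}) :
    v.valuation K (c (π : K) / (π : K)) = WithZero.exp (h : ℤ) := by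
  have h1 : v.valuation K (π : K) = WithZero.exp (-(h : ℤ)) := by
    classical
    rw [HeightOneSpectrum.valuation_of_algebraMap, HeightOneSpectrum.intValuation_if_neg _ hπ0, ← hπ,
      Associates.mk_pow, Associates.count_pow (Associates.mk_ne_zero.mpr v.ne_bot) v.associates_irreducible,
      Associates.count_self v.associates_irreducible, mul_one]
  have h2 : v.valuation K (c (π : K)) = 1 := by
    have hu : c • (c⁻¹ • v) = v := smul_inv_smul c v
    have h3 := HeightOneSpectrum.valuation_algEquiv_smul (F := ℚ) c (c⁻¹ • v) (π : K)
    rw [hu] at h3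
    rw [h3]
    refine valuation_eq_one_of_pow_asIdeal_eq_span hπ (fun h' => hcv ?_)
    have h'' := congrArg (fun u => c • u) h'
    simp only [smul_inv_smul] at h''
    exact h''.symm
  rw [map_div₀, h1, h2, one_div, ← WithZero.exp_neg, neg_neg]

/-- **`Gal(K/ℚ)` permutes the local ideles of a global element over a stable set of places**:
`σ • ∏_{w ∈ S} ⟨k⟩_w = ∏_{w ∈ S} ⟨σ k⟩_w` when `σ S = S` (`σ • ⟨k⟩_w = ⟨σ k⟩_{σ w}`,
Cassels–Fröhlich VII §1.1). [cite: CasselsFrohlichANT1967, Ch. VII §1.1] -/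
theorem smul_prod_localUnits_globalToLocalUnits (σ : K ≃ₐ[ℚ] K) (S : Finset (HeightOneSpectrum (𝓞 K)))
    (hS : ∀ w, w ∈ S ↔ σ • w ∈ S) (k : Kˣ) :
    σ • ∏ w ∈ S, localUnits w (globalToLocalUnits w k) =
      ∏ w ∈ S, localUnits w (globalToLocalUnits w (Units.map (σ : K →* K) k)) := by
  rw [Finset.smul_prod']
  have h1 : ∀ w, σ • localUnits w (globalToLocalUnits w k) =
      localUnits (σ • w) (globalToLocalUnits (σ • w) (Units.map (σ : K →* K) k)) := by
    intro w
    have h := algEquiv_smul_localUnits_unitsToCompletion ℚ K σ w k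
    exact h
  simp_rw [h1]
  exact Finset.prod_nbij (fun w => σ • w) (fun w hw => (hS w).mp hw)
    (fun w₁ _ w₂ _ h => smul_left_cancel σ h)
    (fun w hw => ⟨σ⁻¹ • w, (hS _).mpr (by rw [smul_inv_smul]; exact hw), smul_inv_smul σ w⟩)
    (fun w _ => rfl)

end Quadratic

/-! ### §2. Brink 2007, Theorem 2 -/

section Main

variable (K : Type) [Field K] [NumberField K] (p : ℕ) [Fact p.Prime]

/-- **Discharge of `ZpExtension.decomp_not_le_kerSubgroup_of_isAnticyclotomic` (Brink 2007, Thm. 2,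
last assertion, with Cor. 1): for `K` imaginary quadratic, `κ` an anticyclotomic `ℤ_p`-extension and
`v ∤ p` a finite place of degree one (its rational prime splits in `K`), the decomposition group
`D_v ≤ Γ_K` of the chosen prime above `v` is not contained in `Gal(K̄/K_∞)` — `v` does not split
completely in `K_∞`, i.e. it is finitely decomposed.**  Printed: "Assume that `𝔭` is different from
`l` and splits in `K`. … `𝔭` only splits in a finite number of steps of `K^anti`" (Thm. 2) and "No
rational prime `p` splits completely in `K^anti`" (Cor. 1).  Proof: module docstring (idelic: the
idelic character of `κ` and of the `ℤ_p`-extension from `ℚ` both kill `∏_{w ∣ p} ⟨c(π)/π⟩_w` once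
`Λ(⟨K_vˣ⟩) = 1`, and two independent characters of `U_p ∼ ℤ_p²` kill only torsion, whereas
`|c(π)/π|_v = exp h`).  The hypothesis `p ≠ 2` is not used.
[cite: Brink2007, Thm. 2 (pp. 2134–2135, last assertion) and Cor. 1 (p. 2136); §II Prop. 1 (p. 2130)]
[cite: Lang1990, Ch. 5 §5, Thm. 5.1–5.2] -/
theorem decomp_not_le_kerSubgroup_of_isAnticyclotomic_holds :
    decomp_not_le_kerSubgroup_of_isAnticyclotomic K p := by
  intro hK hp2 κ hκ v hpv he hf hD
  classical
  have hp : p.Prime := Fact.out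
  haveI : IsTotallyComplex K := hK.2
  haveI : Algebra.IsQuadraticExtension ℚ K := ⟨hK.1⟩
  haveI : IsGalois ℚ K := inferInstance
  -- the non-trivial automorphism `c = ḡ` of `K`, from `g ∈ Γ_ℚ ∖ res(Γ_K)`
  obtain ⟨g, hg, -⟩ := exists_not_mem_range_absGaloisRestrict K (Rat.castHom ℝ)
    (fun w => IsTotallyComplex.isComplex w)
  set c : K ≃ₐ[ℚ] K := absGaloisQuot ℚ K g with hcdef
  have hc : c ≠ 1 := fun h1 => hg ((absGaloisQuot_eq_one_iff ℚ K g).mp h1)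
  have hcv : c • v ≠ v := smul_ne_self_of_degree_one hK.1 hc he hf
  -- the two `ℤ_p`-extensions and their idelic characters
  obtain ⟨Λ, hΛ⟩ := exists_idelicCharacter κ.toContinuousMonoidHom
  obtain ⟨κ', hκ'⟩ := exists_zpExtension_fixed_by_conj (p := p) hK.1
  obtain ⟨Λ', hΛ'⟩ := exists_idelicCharacter κ'.toContinuousMonoidHom
  have hΛc : ∀ a : ideleGroup K, Λ (c • a) = (Λ a)⁻¹ := fun a =>
    idelicCharacter_smul_eq_inv hΛ g (fun σ τ hτ => hκ σ τ g hg hτ) a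
  have hΛ'c : ∀ a : ideleGroup K, Λ' (c • a) = Λ' a := fun a =>
    idelicCharacter_smul_eq_self hΛ' g (fun σ τ hτ => hκ' g σ τ hτ) a
  -- a principal power `v^h = (π)` and the global element `k = c(π)/π`
  obtain ⟨h, hh, π, hπ0, hπ⟩ := exists_pow_asIdeal_eq_span (K := K) v
  have hπK : (π : K) ≠ 0 := fun h0 => hπ0 (RingOfIntegers.coe_eq_zero_iff.1 h0)
  set πK : Kˣ := Units.mk0 (π : K) hπK with hπKdef
  set k : Kˣ := Units.map (c : K →* K) πK * πK⁻¹ with hkdef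
  have hk : (k : K) = c (π : K) / (π : K) := by
    rw [hkdef, Units.val_mul, Units.val_inv_eq_inv_val, Units.coe_map, hπKdef, Units.val_mk0,
      div_eq_mul_inv]; rfl
  -- the places above `p`
  haveI : Finite (placesAbove K p) := finite_placesAbove
  haveI : Fintype (placesAbove K p) := Fintype.ofFinite _
  set S : Finset (HeightOneSpectrum (𝓞 K)) :=
    Finset.univ.image (fun w : placesAbove K p => (w.1 : HeightOneSpectrum (𝓞 K))) with hSdef
  have hS : ∀ w : HeightOneSpectrum (𝓞 K), w ∈ S ↔ (p : 𝓞 K) ∈ w.asIdeal := by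
    intro w
    rw [hSdef, Finset.mem_image]
    constructor
    · rintro ⟨w', -, rfl⟩
      exact w'.2
    · intro hw
      exact ⟨⟨w, hw⟩, Finset.mem_univ _, rfl⟩
  have hvS : v ∉ S := fun h => hpv ((hS v).mp h)
  have hcS : ∀ w, w ∈ S ↔ c • w ∈ S := by
    intro w
    rw [hS, hS]
    have h1 := HeightOneSpectrum.smul_mem_smul_asIdeal_iff c w ((p : ℕ) : 𝓞 K)
    rw [show c • ((p : ℕ) : 𝓞 K) = (p : 𝓞 K) from map_natCast (MulSemiringAction.toRingHom _ _ c) p]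
      at h1
    exact h1.symm
  -- (1) `Λ(∏_{w ∣ p} ⟨π⟩_w) = 1`: the product formula for `π` over `S ∪ {v}` and the splitting at `v`
  set P : ideleGroup K := ∏ w ∈ S, localUnits w (globalToLocalUnits w πK) with hPdef
  have hΛP : Λ P = 1 := by
    have hout : ∀ w ∉ insert v S, w.valuation K (πK : K) = 1 := by
      intro w hw
      rw [Finset.mem_insert, not_or] at hw
      rw [hπKdef, Units.val_mk0]
      exact valuation_eq_one_of_pow_asIdeal_eq_span hπ hw.1
    have h1 := idelicCharacter_prod_localUnits_eq_one κ hΛ (insert v S)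
      (fun w hw => Finset.mem_insert_of_mem ((hS w).mpr hw)) πK hout
    rw [Finset.prod_insert hvS, idelicCharacter_localUnits_eq_one_of_decomp_le κ hΛ hD,
      one_mul, ← map_prod] at h1
    exact h1
  -- (2) `Λ(∏_{w ∣ p} ⟨k⟩_w) = 1 = Λ'(∏_{w ∣ p} ⟨k⟩_w)`: Galois transport
  set Q : ideleGroup K := ∏ w ∈ S, localUnits w (globalToLocalUnits w k) with hQdef
  have hQ : Q = c • P * P⁻¹ := by
    rw [hQdef, hPdef, smul_prod_localUnits_globalToLocalUnits c S hcS πK, ← Finset.prod_inv_distrib,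
      ← Finset.prod_mul_distrib]
    refine Finset.prod_congr rfl fun w _ => ?_
    rw [← map_inv, ← map_mul, ← map_inv, ← map_mul, hkdef]
  have hΛQ : Λ Q = 1 := by rw [hQ, map_mul, map_inv, hΛc, hΛP, inv_one, mul_one]
  have hΛ'Q : Λ' Q = 1 := by rw [hQ, map_mul, map_inv, hΛ'c, mul_inv_cancel]
  -- (3) the local units `U_p = ∏_{w ∣ p} 𝒪_wˣ` inside the ideles
  let cU : LocalUnits K p → ∀ w : HeightOneSpectrum (𝓞 K), (w.adicCompletion K)ˣ := fun u w =>
    if hw : (p : 𝓞 K) ∈ w.asIdeal then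
      Units.map ((w.adicCompletionIntegers K).subtype : _ →* _) (u ⟨w, hw⟩) else 1
  have hcU_mem : ∀ (u : LocalUnits K p) {w : HeightOneSpectrum (𝓞 K)} (hw : (p : 𝓞 K) ∈ w.asIdeal),
      cU u w = Units.map ((w.adicCompletionIntegers K).subtype : _ →* _) (u ⟨w, hw⟩) :=
    fun u w hw => dif_pos hw
  have hcU_not : ∀ (u : LocalUnits K p) {w : HeightOneSpectrum (𝓞 K)}, (p : 𝓞 K) ∉ w.asIdeal →
      cU u w = 1 := fun u w hw => dif_neg hw
  let ι : LocalUnits K p →* ideleGroup K :=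
    { toFun := fun u => ∏ w ∈ S, localUnits w (cU u w)
      map_one' := Finset.prod_eq_one fun w _ => by
        by_cases hw : (p : 𝓞 K) ∈ w.asIdeal
        · rw [hcU_mem 1 hw, Pi.one_apply, map_one, map_one]
        · rw [hcU_not 1 hw, map_one]
      map_mul' := fun u u' => by
        rw [← Finset.prod_mul_distrib]
        refine Finset.prod_congr rfl fun w _ => ?_
        rw [← map_mul]
        by_cases hw : (p : 𝓞 K) ∈ w.asIdeal
        · rw [hcU_mem _ hw, hcU_mem _ hw, hcU_mem _ hw, Pi.mul_apply, map_mul]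
        · rw [hcU_not _ hw, hcU_not _ hw, hcU_not _ hw, mul_one] }
  have hι : ∀ u, ι u = ∏ w ∈ S, localUnits w (cU u w) := fun u => rfl
  -- a single local unit
  have hι_single : ∀ (w : HeightOneSpectrum (𝓞 K)) (hw : (p : 𝓞 K) ∈ w.asIdeal)
      (u : (w.adicCompletionIntegers K)ˣ),
      ι (Pi.mulSingle (⟨w, hw⟩ : placesAbove K p) u) =
        localUnits w (Units.map ((w.adicCompletionIntegers K).subtype : _ →* _) u) := by
    intro w hw u
    rw [hι, Finset.prod_eq_single_of_mem w ((hS w).mpr hw)]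
    · rw [hcU_mem _ hw, Pi.mulSingle_eq_same]
    · intro w' hw' hne
      rw [hcU_mem _ ((hS w').mp hw'), Pi.mulSingle_eq_of_ne (fun heq => hne (congrArg Subtype.val heq)),
        map_one, map_one]
  -- the element `k` of `U_p`
  have hkval : ∀ w : placesAbove K p,
      Valued.v ((globalToLocalUnits w.1 k : (w.1.adicCompletion K)ˣ) : w.1.adicCompletion K) = 1 := by
    intro w
    have hwv : w.1 ≠ v := fun heq => hpv (heq ▸ w.2)
    have hwcv : w.1 ≠ c • v := by
      intro heq
      have h1 : (p : 𝓞 K) ∈ (c • v).asIdeal := heq ▸ w.2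
      exact hvS ((hcS v).mpr ((hS _).mpr h1))
    rw [val_globalToLocalUnits, GaloisRepresentations.valued_algebraMap_adicCompletion, hk]
    exact valuation_div_eq_one c hwv hwcv hπ
  have hkunit : ∀ w : placesAbove K p, ∃ u : (w.1.adicCompletionIntegers K)ˣ,
      Units.map ((w.1.adicCompletionIntegers K).subtype : _ →* _) u = globalToLocalUnits w.1 k :=
    fun w => IdelicCharacter.exists_unitsMap_eq_of_valued_eq_one _ (hkval w)
  choose kU hkU using hkunit
  have hιk : ι kU = Q := by
    rw [hι, hQdef]
    refine Finset.prod_congr rfl fun w hw => ?_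
    rw [hcU_mem kU ((hS w).mp hw), hkU ⟨w, _⟩]
  -- (4) the two characters of `U_p` and their independence
  set l₁ : LocalUnits K p →* Multiplicative ℤ_[p] := Λ.toMonoidHom.comp ι with hl₁
  set l₂ : LocalUnits K p →* Multiplicative ℤ_[p] := Λ'.toMonoidHom.comp ι with hl₂
  have hl₁k : l₁ kU = 1 := by
    change Λ (ι kU) = 1
    rw [hιk, hΛQ]
  have hl₂k : l₂ kU = 1 := by
    change Λ' (ι kU) = 1
    rw [hιk, hΛ'Q]
  have hind : ∀ a b : ℤ_[p], (∀ x : LocalUnits K p, a * (l₁ x).toAdd + b * (l₂ x).toAdd = 0) →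
      a = 0 ∧ b = 0 := by
    intro a b hab
    refine eq_zero_of_forall_localUnits hK κ hκ κ' hκ' hΛ hΛ' fun w hw u => ?_
    have h1 := hab (Pi.mulSingle (⟨w, hw⟩ : placesAbove K p) u)
    change a * (Λ (ι _)).toAdd + b * (Λ' (ι _)).toAdd = 0 at h1
    rwa [hι_single w hw u] at h1
  -- (5) `U_p ⊇ W ≅ ℤ_p²` and the rank-two lemma: `k^m = 1` in `U_p`
  obtain ⟨W, -, hWfi, ⟨e⟩⟩ := exists_openSubgroup_localUnits_equiv_holds K p
  haveI := hWfi
  rw [hK.1] at e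
  have hpow : kU ^ W.index = 1 := pow_index_eq_one_of_apply_eq_one W e.toMulEquiv l₁ l₂ hind hl₁k hl₂k
  have hm0 : W.index ≠ 0 := Subgroup.FiniteIndex.index_ne_zero
  -- (6) read at a place `w₀ ∣ p`: `k^m = 1` in `K`, contradicting `|k|_v = exp h ≠ 1`
  obtain ⟨w₀, hw₀⟩ : ∃ w₀ : HeightOneSpectrum (𝓞 K), (p : 𝓞 K) ∈ w₀.asIdeal := by
    have hnu : ¬ IsUnit ((p : 𝓞 K)) := fun hu => by
      have h1 := hu.map (Algebra.norm ℤ)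
      rw [← map_natCast (algebraMap ℤ (𝓞 K)) p, Algebra.norm_algebraMap, Int.isUnit_iff_natAbs_eq,
        Int.natAbs_pow, Int.natAbs_natCast] at h1
      exact (Nat.one_lt_pow (Module.finrank_pos (R := ℤ) (M := 𝓞 K)).ne' hp.one_lt).ne' h1
    obtain ⟨M, hM, hle⟩ := Ideal.exists_le_maximal (Ideal.span {(p : 𝓞 K)})
      (by rwa [Ne, Ideal.span_singleton_eq_top])
    refine ⟨⟨M, hM.isPrime, fun hbot => ?_⟩, hle (Ideal.mem_span_singleton_self _)⟩
    have h := hle (Ideal.mem_span_singleton_self _)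
    rw [hbot, Ideal.mem_bot] at h
    exact (Nat.cast_ne_zero.2 hp.ne_zero) h
  have hkm : ((k : K) ^ W.index : K) = 1 := by
    have h1 := congrArg (fun u : LocalUnits K p => ((Units.map ((w₀.adicCompletionIntegers K).subtype : _ →* _)
      (u ⟨w₀, hw₀⟩) : (w₀.adicCompletion K)ˣ) : w₀.adicCompletion K)) hpow
    simp only [Pi.pow_apply, map_pow, Units.val_pow_eq_pow_val, Pi.one_apply, map_one, Units.val_one] at h1
    rw [hkU ⟨w₀, hw₀⟩, val_globalToLocalUnits, ← map_pow, ← map_one (algebraMap K (w₀.adicCompletion K))] at h1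
    exact (algebraMap K (w₀.adicCompletion K)).injective h1
  have hval : v.valuation K ((k : K) ^ W.index) = 1 := by rw [hkm, map_one]
  rw [map_pow, hk, valuation_div_eq_exp c hcv hπ0 hπ, ← WithZero.exp_nsmul, nsmul_eq_mul,
    ← WithZero.exp_zero, WithZero.exp_injective.eq_iff] at hval
  have : (W.index : ℤ) * (h : ℤ) ≠ 0 := mul_ne_zero (Nat.cast_ne_zero.mpr hm0) (Nat.cast_ne_zero.mpr hh)
  exact this hval

end Main

end Literature.NumberTheory.EllipticCurves.ZpExtension

end
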